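import Literature.MathematicalPhysics.QuantumFieldTheory.Balaban1983to89.Beta.HessKerSchur
import Summits.QuantumFields.BalabanUV.Beta.GAN24.MonotoneCauchy

/-!
# Beta / GAN24 / MonotoneSchur — the monotone route's Cauchy band in asym1's WEIGHTED SCHUR budget (no rate halving, no lattice constant per composition)
# (gan24-p4, BINDER-OWNERS row G-an2-4 ∕ (CONV-C), ALTERNATIVE DISCHARGE «rate OR monotonicity»; NOT IN PRINT — our proof attempt)

HONEST FRAMING (page 1 of everything the β sub-cell writes): discharging `BetaPertH` makes Bałaban's UV stability UNCONDITIONAL — a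
real constructive-QFT result; it is NOT the continuum limit and NOT the Clay problem.  HONEST DEPENDENCY (cell reorg 2026-08-19, verbatim):
«continuum YM on T⁴ ⇐ BetaPertH ∧ nine spine estimates (0/9 proved); BetaPertH ⇐ (D1) ∧ (D4) ∧ CAP+tail; G-an2-4 gates asym, D1 and NE2/3/4.»
HONEST LABEL: «not in print; our proof attempt; alternative discharge of the G-an2-4 row (rate OR monotonicity)»; 0 binders instantiated.

ABSOLUTE RULE (cell charter, verbatim): "No internally-minted statement may enter as a cited fact. Every hypothesis is either
kernel-proved in this package or a verbatim quotation of a PUBLISHED theorem with page reference. The manuscript(s) under audit are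
NOT citable for their own disputed steps — they are the thing under adjudication; programme-internal (2001/route/tribunal) claims
are never citable."  Nothing is cited; [folklore] throughout.

## WHY (caveat Q-gan24p4-1 of `HOME/b2b-balaban-gan24-p4/MONOTONE.md`).  The band width of `GAN24/MonotoneCauchy` is budgeted through
`HessKerRate.lipConst` (decay `δ/8`, a lattice constant `Zl` per composition and trace); usefulness of the floor `min m₀ (m − width)` needs
`width < m − r`, so the size of the budget decides how far the certified rows must reach.  asym1's `HessKerSchur` re-budgets the SAME Lipschitz
chain in exponentially weighted Schur classes (`ColW`, `VertexFamilyW`, `VertexFamily₂W`): constant `lipW` POLYNOMIAL in the class bounds, LINEAR in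
the deviations, decay `R·N`, no `Zl` inside.  This file is the monotone route's Cauchy band in that budget: the (MONO-K)-W input is a pairwise
WEIGHTED-COLUMN band `ColWCauchyBand A R εA k₀` of the resolvent slot; §3 shows it follows from the sup-norm form (MONO-K)₂ `SupCauchyBand` + (I3)
(`colW_of_decays` on the interpolated pairwise decay, ONE `Zl` paid once), so the structural input is unchanged — only the bookkeeping is tighter.
-/

namespace Summit.QuantumFields.BalabanUV.Beta.GAN24.MonotoneSchur

open Literature.MathematicalPhysics.QuantumFieldTheory.Balaban1983to89
open Literature.MathematicalPhysics.QuantumFieldTheory.Balaban1983to89.Beta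
open FlowStep
open B12Sec2to5 (betaPrime510)
open B12Beta (secondMoment)
open ExpKernelCalculus (Site MKer Decays hessKer Zl)
open HessKerSchur (ColW VertexFamilyW VertexFamily₂W lipW geomRate_secondMoment_hessKer_W colW_of_decays)
open Beta.RemainderChain (RemainderConst)
open Beta.AveragedAFCarrier (BetaAvgAFH)
open Summit.QuantumFields.BalabanUV.Beta.CapRows
open Summit.QuantumFields.BalabanUV.Beta.GAN24.MonotoneCauchy (EventualCauchyBand SupCauchyBand betaAvgAFH_of_rows_eventualCauchyBand
  cauchyDecays_of_uniform_supCauchyBand)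

variable {D : ℕ} {F : Type*} [Fintype F]

/-! ## §1 The weighted pairwise band of the resolvent slot -/

/-- SOCKET (MONO-K)-W: pairwise WEIGHTED-COLUMN band of the family beyond `k₀` — `ColW (A j − A j') R ε` for all `j, j' ≥ k₀` (asym1's class
`HessKerSchur.ColW`).  A binder shape; nothing asserted. [folklore] -/
def ColWCauchyBand (A : ℕ → MKer D F) (R ε : ℝ) (k₀ : ℕ) : Prop := ∀ j j', k₀ ≤ j → k₀ ≤ j' → ColW (A j - A j') R ε

/-! ## §2 The Cauchy band of the moments in the weighted budget -/

section Band

variable {A : ℕ → MKer D F} {V : ℕ → Fin D → Site D → MKer D F} {W : ℕ → Fin D → Site D → Fin D → Site D → MKer D F}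
  {R BA BV BW εA εV εW : ℝ} {N k₀ : ℕ}

/-- **PAIRWISE WEIGHTED DEVIATIONS ⟹ CAUCHY BAND, TIGHT BUDGET**: `j`-uniform weighted data `ColW (A j) R B_A`, `VertexFamilyW (V j) N R B_V`,
`VertexFamily₂W (W j) N R B_W` and, for `j, j' ≥ k₀`, `ColW (A j − A j') R εA`, `VertexFamilyW (V j − V j') N R εV`, `VertexFamily₂W (W j − W j') N R εW`
⟹ `EventualCauchyBand (j ↦ secondMoment (hessKer (A j)(V j)(W j)) μ ν) (betaPrime510 D (lipW B_A B_A B_V B_V B_W εA εV εW) (R·N)) k₀`.  Proof: asym1's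
`geomRate_secondMoment_hessKer_W` at `θ = 1` on the shifted family with REFERENCE `(A j', V j', W j')`. [folklore] -/
theorem eventualCauchyBand_secondMoment_hessKer_W (hA : ∀ j, ColW (A j) R BA) (hV : ∀ j, VertexFamilyW (V j) N R BV)
    (hW : ∀ j, VertexFamily₂W (W j) N R BW) (hAdev : ColWCauchyBand A R εA k₀)
    (hVdev : ∀ j j', k₀ ≤ j → k₀ ≤ j' → VertexFamilyW (V j - V j') N R εV)
    (hWdev : ∀ j j', k₀ ≤ j → k₀ ≤ j' → VertexFamily₂W (W j - W j') N R εW) (hR : 0 < R) (hN : 1 ≤ N) (μ ν : Fin D) :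
    EventualCauchyBand (fun j => secondMoment (hessKer (A j) (V j) (W j)) μ ν)
      (betaPrime510 D (lipW BA BA BV BV BW εA εV εW) (R * N)) k₀ := by
  intro j j' hj hj'
  have h := geomRate_secondMoment_hessKer_W (θ := 1) (cA := εA) (cV := εV) (cW := εW)
    (A := fun i => A (k₀ + i)) (V := fun i => V (k₀ + i)) (W := fun i => W (k₀ + i)) (Ainf := A j') (Vinf := V j') (Winf := W j')
    (fun i => hA (k₀ + i)) (hA j') (fun i => by simpa using hAdev (k₀ + i) j' (Nat.le_add_right _ _) hj')
    (fun i => hV (k₀ + i)) (hV j') (fun i => by simpa using hVdev (k₀ + i) j' (Nat.le_add_right _ _) hj')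
    (fun i => hW (k₀ + i)) (hW j') (fun i => by simpa using hWdev (k₀ + i) j' (Nat.le_add_right _ _) hj') hR hN μ ν (j - k₀)
  simp only [one_pow, mul_one] at h
  rwa [Nat.add_sub_cancel' hj] at h

variable {β : HBeta}

/-- **MEETING THEOREM, TIGHT BUDGET (limit-free, end to end)**: rows `c : CapRows.Rows S.β0` (beta-an5, literally) × dictionary `hβ` × weighted uniform
data × (MONO-K)-W + pairwise jet deviations from `k₀ ≤ c.k₀` × constant remainder ⟹ `BetaAvgAFH (min m₀ (m − betaPrime510 D (lipW …) (R·N)) − r) 0 γ₀ β`.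
No rate, no limit object, no limit identification; width polynomial in the class bounds and linear in `(εA, εV, εW)`. [folklore] -/
theorem betaAvgAFH_of_rows_colWCauchyBand (S : B12Beta.OneLoopSplit β) (c : Rows S.β0) {μ ν : Fin D}
    (hβ : ∀ j, S.β0 j = secondMoment (hessKer (A j) (V j) (W j)) μ ν)
    (hA : ∀ j, ColW (A j) R BA) (hV : ∀ j, VertexFamilyW (V j) N R BV) (hW : ∀ j, VertexFamily₂W (W j) N R BW)
    (hAdev : ColWCauchyBand A R εA k₀) (hVdev : ∀ j j', k₀ ≤ j → k₀ ≤ j' → VertexFamilyW (V j - V j') N R εV)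
    (hWdev : ∀ j j', k₀ ≤ j → k₀ ≤ j' → VertexFamily₂W (W j - W j') N R εW) (hR : 0 < R) (hN : 1 ≤ N) (hk₀ : k₀ ≤ c.k₀)
    {γ₀ r : ℝ} (hrem : RemainderConst S γ₀ r) :
    BetaAvgAFH (min ((c.m₀ : ℚ) : ℝ) ((c.m : ℚ) - betaPrime510 D (lipW BA BA BV BV BW εA εV εW) (R * N)) - r) 0 γ₀ β := by
  have hband := eventualCauchyBand_secondMoment_hessKer_W hA hV hW hAdev hVdev hWdev hR hN μ ν
  have hband' : EventualCauchyBand S.β0 (betaPrime510 D (lipW BA BA BV BV BW εA εV εW) (R * N)) k₀ := by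
    intro j j' hj hj'
    rw [hβ j, hβ j']
    exact hband j j' hj hj'
  exact betaAvgAFH_of_rows_eventualCauchyBand S c hband' hk₀ hrem

end Band

/-! ## §3 The structural input is unchanged: (MONO-K)₂ (sup form) + (I3) ⟹ (MONO-K)-W, one lattice constant paid once -/

section FromSup

variable {A : ℕ → MKer D F} {C δ η₀ R : ℝ} {k₀ : ℕ}

/-- **(MONO-K)₂ + (I3) ⟹ (MONO-K)-W**: uniform `Decays (A j) C δ`, the sup band `SupCauchyBand A η₀ k₀` (`η₀ ≥ 0`) and a weight `R < δ/2` give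
`ColWCauchyBand A R (|F|·√(η₀·(C + C))·Zl(δ/2 − R)) k₀` (`MonotoneCauchy.cauchyDecays_of_uniform_supCauchyBand` + asym1's `colW_of_decays`). [folklore] -/
theorem colWCauchyBand_of_supCauchyBand (hA : ∀ j, Decays (A j) C δ) (hη : 0 ≤ η₀) (hsup : SupCauchyBand A η₀ k₀) (hR : R < δ / 2) :
    ColWCauchyBand A R ((Fintype.card F : ℝ) * Real.sqrt (η₀ * (C + C)) * Zl D (δ / 2 - R)) k₀ := fun j j' hj hj' =>
  colW_of_decays (cauchyDecays_of_uniform_supCauchyBand hA hη hsup j j' hj hj') hR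

/-- NON-VACUITY: a constant family has the weighted band `0` (at any weight). [folklore] -/
theorem colWCauchyBand_const (A₀ : MKer D F) (R : ℝ) (k₀ : ℕ) : ColWCauchyBand (fun _ => A₀) R 0 k₀ := by
  intro j j' _ _
  refine ⟨le_rfl, fun y b s => ?_⟩
  simp

end FromSup

end Summit.QuantumFields.BalabanUV.Beta.GAN24.MonotoneSchur
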